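import Summits.QuantumFields.YangMills.Theorems.BalabanUVNodesN19RateEdgeHolder
import Summits.QuantumFields.YangMills.Theorems.BalabanUVNodesN27AtRecord13CoPHKeyedCore
import Summits.QuantumFields.YangMills.Theorems.BalabanUVNodesRateCarriersOfRecord13CoPH

/-!
# BalabanUVNodes ∕ N19 — THE R-β RATE EDGE AT THE STAGE-13 `CoPH` RECORD TUPLES: leaf D's N19 slot `h19` (`RatesHolderAt … β → ∃ δ, NE7.Core … δ ∧ Summable δ`)
# INHABITED BY NAME MODULO THE DISPLAYED LINK READING (NODE O's `LedgerDataSync` world), and the K3⁷ composers with N19's binder so replaced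

Cell `pub-ymgap`, HUMAN RULING D-0062 (Track A) + D-0149 (work-bound push, director-ym №197), R134 ACCELERATION seat `pub-ymgap-dag-n19-d`
(N19 NE7, strategy s2 = by-name knit at the record), generation g22; bus INTENT-F (I.24019).  Route
`Summits/QuantumFields/YangMills/Theses/BalabanUVNodes.lean` rev 25, cluster item K3⁷ «SpineGivenEndpointR13SepCoPH» (stmt-QuantumFields-20544); filed
`--kind proof --supports` that item `--as helper` (it proves no registered stub).  COUNT-NEUTRAL.  THEOREMS ONLY; 0 `def`; 0 `sorry`; `N`-generic; NO Theses
import.  Imports the sibling `…N19RateEdgeHolder` (INTENT-E: the generic R-β edge `rateEdge_of_linkReading_byName_pairDiscC1Holder`), dag-n27-c's XXIVc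
`…N27AtRecord13CoPHKeyedCore` and dag-n22-e's `…RateCarriersOfRecord13CoPH` (`rateCarriersOfRecord₁₃CoPH`) — all CITED BY NAME, none edited.

WHAT THIS FILE PROVES (`N`-generic).
* §1 ★ `h19Holder_datumOfRecord₁₃CoPH_of_linkReading` — for any θ-keyed spine reading `cr` (leaf D's `cr`), any rate reading of record `𝔯 : RateReading₁₃CoPH N`
  (dag-n22-e), any guard `G`, any `β ≤ 1`: IF the link reading `hlink` holds AT THE RECORD TUPLES — for every admissible Stage-13 `θ` with provisos in the guard,
  every `g₀`, `os` and run length `k`, the «v9» ∃-clause of `N19RateEdgeHolder` (VERBATIM, under `let S := cr F θ hP g₀ os; let R := rateCarriersOfRecord₁₃CoPH 𝔯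
  F θ hP g₀ os k; let D := datumOfRecord₁₃CoPH F N θ hP`) — THEN leaf D's N19 slot holds LITERALLY: `RatesHolderAt (datumOfRecord₁₃CoPH F N θ hP)
  (rateCarriersOfRecord₁₃CoPH 𝔯 F θ hP g₀ os k) β → ∃ δ, NE7.Core (cr …).l₀ (cr …).vol (cr …).T (cr …).Bad (A − shA) (B − shB) δ ∧ Summable δ`.  Proof: the sibling's
  edge at the SAME-TUPLE pair predicate `PRec F D g₀ os S R := ∃ θ hP k, G θ ∧ θ.Admissible ∧ D = datumOfRecord₁₃CoPH F N θ hP ∧ S = cr F θ hP g₀ os ∧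
  R = rateCarriersOfRecord₁₃CoPH 𝔯 F θ hP g₀ os k` (spine AND rate carriers pinned at ONE tuple — node00-def-RR-2's located same-key point; no mixed pairs).
* §2 ★ `hybridNE7Under_guarded_datumOfRecord₁₃CoPH_of_keyedFacesRatesHolder_linkReading` — dag-n27-c XXIVc `keyedGuarded₁₃CoPH_of_keyedFacesRatesHolder` with its
  `h19` binder DISCHARGED by §1: from N20's `h20`, N21's `h21`, K4's β-rates `hrates`, the keyed extraction `hx` (all VERBATIM XXIVc, for the rate reading
  `rr F θ hP g₀ os := rateCarriersOfRecord₁₃CoPH 𝔯 F θ hP g₀ os (ks F θ hP g₀ os)` with ANY run-length selector `ks`) AND `hlink` ⇒ `HybridNE7Under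
  (datumOfRecord₁₃CoPH F N θ hP) END` at every guarded admissible tuple.
* (sibling `…N19RateEdgeHolderK3R13SepCoPH`, `N = 2`, Theses importer) leaf D's ★★ K3⁷ face `spineGivenEndpointR13SepCoPH_of_keyedFacesRatesHolder` with `h19` so
  discharged: `SpineGivenEndpointR13SepCoPH` BY NAME from `h20 h21 hrates hx` + `hlink`.  N19's displayed residual at the K3⁷ record in the plan's R-β currency
  is thereby EXACTLY the link reading: NODE O's two-run booking `LedgerDataSync R.u3.C F′ ι′ S.ι` + ledger predicate + reference-ledger
  lattice identification + [III] Thm 2 (2.43) window letters AS PRINTED + N14's positional-count pair + the N16∕N17 side letters + (T) in the tube currency —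
  the object-bound (F) of dag-n19-a's `N19-EDGE-CENSUS.md`, now at the CURRENT record (Stage-13 `CoPH`) AND currency (R-β).

HONEST FRAMING.  Count-neutral kernel bookkeeping; `hlink` is a HYPOTHESIS (NODE O's world, K2⁷; 0 instances in the tree); `h20` (N20), `h21` (N21), `hrates` (K4's six
β-rates: N14 · N15 · N16 at exponent β · N17 · N18 · N22), `hx` (N27's keyed extraction) are HYPOTHESES; `cr`, `𝔯`, `G`, `ks` are PARAMETERS.  NE7 for Bałaban's two
runs is NOT PRINTED and NOT proved; nothing of Bałaban's is asserted; N19 NOT discharged; Track A count unmoved (5∕27 · A 5∕28).  One finite four-torus at fixed ε,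
rung (B)+1 — NOT infinite volume, NOT OS on ℝ⁴, NOT a mass gap, NOT Clay.  Standard axioms.  Supersedes nothing; edits nothing.
-/

set_option autoImplicit false

noncomputable section

open Finset MeasureTheory
open scoped BigOperators Matrix Matrix.Norms.L2Operator

namespace Summit.QuantumFields.YangMills.BalabanUVNodes.N19RateEdgeHolderAtRecord13CoPH

open Literature.MathematicalPhysics.QuantumFieldTheory.Balaban1983to89
open T4OutputRate T4RecentScale T4GoodClassBudget T4CauchySum T4TowerRateComposition T4TowerRateDischarge
open T4EtaRateMin (Readings NE3Shape)
open T4RateLiaison (GaugeDominated)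
open T4CouplingMatching (EventualLowerH)
open FlowStep (RGEqH)
open TreeLengthTorus (TFaceConnected torusTreeLen)
open B12TreeDecay (kappa₀)
open Summit.QuantumFields.BalabanUV.T4Continuum
open AveragingDeficitDualResidual (dualC1 dualC2)
open AveragingDeficitDerivWallProof (wallConst)
open AveragingDeficitPeriodicCounting (IsPeriodicDir)
open MinimalActionSandwich (IsMinimiser minAct)
open MinimalActionRate (sfClass)
open MinimalActionRefine (RegularSup gradConst)
open NE3EnergyShapes (IsUnitarySite IsPeriodicSite)
open NE3.LeafIndexSockets (LeafH3sup)
open Summit.QuantumFields.BalabanUV.T4Continuum.Spine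
open Summit.QuantumFields.BalabanUV.T4Continuum.NE1p.DressedRoot (DressedTower DressedStabilityStrict)
open Summit.QuantumFields.YangMills.BalabanUVNodes.N19LedgerLinkSync (LedgerDataSync LedgerAtSync core_summable_of_ledgerAtSync)
open Summit.QuantumFields.YangMills.BalabanUVNodes.N19MultiplicityByName (core_summable_of_ledgerAtSync_multByName)
open Summit.QuantumFields.YangMills.BalabanUVNodes.N19RateEdge (ne5_of_n18At dressedStabilityStrict_of_n14At)
open Summit.QuantumFields.YangMills.BalabanUVNodes.N19InEdgesAtRecord (ledgerAtSync_withLoc ne3Liaison_of_covRoot injectedRate_of_n17At_readOutAt)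
open Summit.QuantumFields.YangMills.BalabanUVNodes.N19LipBracketTube (lipBracket_of_pairDisc lipBracket_at_rateCarriers_of_pairDisc)
open YMDAG.UVSplit (SpineCarriers SpineRecordPred InputsPred U3Carriers RateCarriers RateRecordPred N14At N18At N22At ReadOutAt)
open Summit.QuantumFields.YangMills.BalabanUVNodes.N16HolderDefs (CovRootHolder N16HolderAt)
open Summit.QuantumFields.YangMills.BalabanUVNodes.SpineRatesHolder (RatesHolderAt)
open Summit.QuantumFields.YangMills.BalabanUVNodes.N19LiaisonC1Holder (ne3LiaisonC1_of_covRootHolder)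
open Literature.MathematicalPhysics.QuantumFieldTheory.Balaban1983to89.T4Continuum (T4Family ULoop)
open T4WeightBudget (RelWeightBound)
open T4IndicatorShell (ShellWeightBound)
open T4ContinuumYM4Torus (ForSmallCouplings)
open T4ApexHybrid (HybridNE7Under)
open YMDAG.UVSplit (Datum RateReading₁₃CoPH rateCarriersOfRecord₁₃CoPH)
open Node00 (Stage13HParams datumOfRecord₁₃CoPH)
open Summit.QuantumFields.YangMills.BalabanUVNodes.N19RateEdgeHolder (rateEdge_of_linkReading_byName_pairDiscC1Holder)
open Summit.QuantumFields.YangMills.Theorems.BalabanUVNodesN27SpineRecord (keyedGuarded₁₃CoPH_of_keyedFacesRatesHolder)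

/-! ## §1 The link reading AT THE RECORD TUPLES ⇒ leaf D's θ-keyed N19 slot in the R-β currency -/

section AtRecord

variable {N : ℕ} [NeZero N]
  (cr : (F : T4Family) → (θ : Stage13HParams F N) → θ.Provisos₁₃CoPH F N → (ℕ → ℝ) → List (ULoop F) → SpineCarriers)
  (𝔯 : RateReading₁₃CoPH N) (G : ∀ {F : T4Family}, Stage13HParams F N → Prop) {β : ℝ} (hβ1 : β ≤ 1)
  (hlink : ∀ (F : T4Family) (θ : Stage13HParams F N) (hP : θ.Provisos₁₃CoPH F N), G θ → θ.Admissible F N →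
    ∀ (g₀ : ℕ → ℝ) (os : List (ULoop F)) (k : ℕ),
      let S : SpineCarriers := cr F θ hP g₀ os
      let R : RateCarriers N := rateCarriersOfRecord₁₃CoPH 𝔯 F θ hP g₀ os k
      let D : Datum F N := datumOfRecord₁₃CoPH F N θ hP
      letI := S.dec
      ∃ (_ : DecidableEq R.u3.C.Dom) (F' : Type) (ι' X' : Type) (_ : MeasurableSpace ι')
        (L : LedgerDataSync R.u3.C F' ι' S.ι) (Rd : Readings ι' X') (bsel : (ℕ → ℝ) → ℝ) (EB : Functional R.u3.C R.u3.C.BgB)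
        (θc θ₃ : ℝ) (g : ℕ → ℕ → ℝ)
        (uA : ℕ → ι' → R.u3.C.BgA) (uB : ℕ → ι' → R.u3.C.BgB)
        (Pf : ℕ → Params) (d₀ L₀ Koff : ℕ) (cells : (K j : ℕ) → R.u3.C.Dom → Finset (Site (Pf K) j))
        (H033 : Flow → ℕ → Prop) (I : Type) (fam : I → B14.Sect2Data) (Lb βw : ℝ) (κ₁ : ℕ) (Gv Cl : ℝ) (K₁ : ℕ)
        (Λ₀ N₀ : ℝ) (dressed : R.u3.C.Dom → Prop) (_ : DecidablePred dressed)
        -- N16-side letters: regime, selection, reading map, NE7 route-#1 side letters, offset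
        (c' t ε₁ θ γ₃ l₁ : ℝ)
        (sel : ℕ → (B7Prop1Explicit.Site 4 → Fin 4 → (Matrix (Fin N) (Fin N) ℂ)ˣ) → (B7Prop1Explicit.Site 4 → Fin 4 → (Matrix (Fin N) (Fin N) ℂ)ˣ))
        (rd : ι' → (B7Prop1Explicit.Site 4 → Fin 4 → (Matrix (Fin N) (Fin N) ℂ)ˣ)) (k₀ : ℕ)
        -- N17-side letters: infrared pin, β-window
        (gIR bβ : ℝ) (k₀β : ℕ)
        -- TUBE letters of the bracket (T): the (1.18) constant, the layer factor and (2.28)'s `C₁, q₁`, the flow's `β′`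
        (E₀T κ₁T C₁T β'T : ℝ) (q₁ : ℕ),
        -- the run-B functional is the first-coupling family read through the selector
        EB = (fun s => R.u3.EB (bsel s) s) ∧
        -- (i) the ledger predicate for whatever size data and census constants meet their clauses
        (∀ (Sz : ℕ → ℝ → S.ι → ℕ → ℝ) (E₀ : ℝ) (m : ℕ) (a : ℝ) (Cw Λg : ℝ),
          (∀ K t, |t| ≤ S.l₀ → ∀ τ ∈ S.T K \ S.Bad K t, ∀ v ∈ Rd.dom, ∀ j ≤ K,
            |∑ X ∈ L.fac K t τ with R.u3.C.scale X = j,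
                (Real.log (Real.exp (EB (fun i => g (K + 1) (i + 1)) (uB K v) X
                    - EB (fun i => g (K + 1) (i + 1)) L.oneB X))
                  - Real.log (Real.exp (R.u3.EA (g K) (uA K v) X - R.u3.EA (g K) L.oneA X)))| ≤ Sz K t τ j) →
          0 ≤ E₀ → 0 < a → a < 1 →
          (∀ K t, |t| ≤ S.l₀ → ∀ τ ∈ S.T K \ S.Bad K t, ∀ j ≤ K,
            Sz K t τ j ≤ S.vol * (E₀ * ((K : ℝ) + 1) ^ m * a ^ (K - j))) →
          (∀ K, Multiplicity (L.All K) R.u3.C.scale (fun X => Real.exp (-(R.u3.κ * R.u3.C.d X))) Cw S.vol Λg K) →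
          (∀ K t, |t| ≤ S.l₀ → ∀ τ ∈ S.T K \ S.Bad K t,
            WindowMultiplicity (L.facO K t τ) L.scO L.wO Cw S.vol Λg (jlogOf L.Cl K) K) →
          1 ≤ Λg → L.θ' ≤ Λg →
          LedgerAtSync { L with S := Sz, E₀ := E₀, m := m, a := a, Cw := Cw, Λg := Λg } S.l₀ S.vol S.T S.Bad
            (fun K t τ => S.A K t τ - S.shA K t τ) (fun K t τ => S.B K t τ - S.shB K t τ) Rd R.u3.EA EB R.u3.κ g uA uB
            R.u3.ω θc R.u3.θ θ₃) ∧
        0 ≤ S.vol ∧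
        (∀ K t, |t| ≤ S.l₀ → ∀ τ ∈ S.T K \ S.Bad K t,
          WindowMultiplicity (L.facO K t τ) L.scO L.wO L.Cw S.vol L.Λg (jlogOf L.Cl K) K) ∧
        0 ≤ L.Cw ∧ 1 ≤ L.Λg ∧ L.θ' ≤ L.Λg ∧
        -- (ii-m) the reference ledger's lattice identification
        (∀ K, (Pf K).d = d₀) ∧ (∀ K, (Pf K).L = L₀) ∧ (∀ K, (Pf K).K = Koff + K) ∧
        (∀ K, (Fintype.card (Site (Pf K) (Pf K).K) : ℝ) = S.vol) ∧
        kappa₀ (4 * 2 ^ d₀) (2 * d₀) ≤ R.u3.κ ∧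
        (∀ K, ∀ X ∈ L.All K,
          (cells K (R.u3.C.scale X + Koff) X).Nonempty ∧ TFaceConnected (cells K (R.u3.C.scale X + Koff) X)) ∧
        (∀ K j, Set.InjOn (cells K j) ↑((L.All K).filter fun X => R.u3.C.scale X + Koff = j)) ∧
        (∀ K, ∀ X ∈ L.All K, torusTreeLen (cells K (R.u3.C.scale X + Koff) X) ≤ R.u3.C.d X) ∧
        -- (iii) [III] Theorem 2 (2.43) AS PRINTED with window letters
        B14.Thm2Printed H033 fam Lb βw κ₁ ∧ βw < 1 ∧ 0 < βw ∧ 1 < Lb ∧ 1 ≤ Gv ∧ 0 ≤ Cl ∧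
        -- (iv) the positional-count half of N14's pinned pair at a rate `≤ R.ne1.Λ`
        (∀ p K, (R.ne1.𝒯.B p K).PositionalCount fun j k => N₀ * Λ₀ ^ (k - j)) ∧ 0 ≤ N₀ ∧ 0 ≤ Λ₀ ∧ Λ₀ ≤ R.ne1.Λ ∧
        -- (ii-v-A) run A's vacuum slices ↔ printed E-terms
        (∀ K t, |t| ≤ S.l₀ → ∀ τ ∈ S.T K \ S.Bad K t, ∀ v ∈ Rd.dom, ∀ j ≤ K, ∃ (i : I) (w : (fam i).Ω) (j' : ℕ),
          (fam i).flow.SatisfiesRG (fam i).K ∧ H033 (fam i).flow (fam i).K ∧ 1 ≤ j' ∧ j' ≤ (fam i).K ∧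
          (fam i).K - j' = K - j ∧ (fam i).K ≤ K + K₁ ∧
          (∀ n, 0 ≤ (fam i).gammaVol n w) ∧ (fam i).gammaVol (fam i).K w ≤ S.vol ∧
          (∀ n, n < (fam i).K → n < jlogOf Cl (fam i).K → (fam i).gammaVol n w = 0) ∧
          (∀ n, n < (fam i).K → jlogOf Cl (fam i).K ≤ n → (fam i).gammaVol n w ≤ S.vol * Gv ^ ((fam i).K - n)) ∧
          |∑ X ∈ (L.fac K t τ).filter (fun X => ¬ dressed X) with R.u3.C.scale X = j,
              (R.u3.EA (g K) (uA K v) X - R.u3.EA (g K) L.oneA X)| ≤ |(fam i).eTerm j' (fam i).K w|) ∧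
        -- (ii-v-B) run B's vacuum slices ↔ printed E-terms
        (∀ K t, |t| ≤ S.l₀ → ∀ τ ∈ S.T K \ S.Bad K t, ∀ v ∈ Rd.dom, ∀ j ≤ K, ∃ (i : I) (w : (fam i).Ω) (j' : ℕ),
          (fam i).flow.SatisfiesRG (fam i).K ∧ H033 (fam i).flow (fam i).K ∧ 1 ≤ j' ∧ j' ≤ (fam i).K ∧
          (fam i).K - j' = K - j ∧ (fam i).K ≤ K + K₁ ∧
          (∀ n, 0 ≤ (fam i).gammaVol n w) ∧ (fam i).gammaVol (fam i).K w ≤ S.vol ∧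
          (∀ n, n < (fam i).K → n < jlogOf Cl (fam i).K → (fam i).gammaVol n w = 0) ∧
          (∀ n, n < (fam i).K → jlogOf Cl (fam i).K ≤ n → (fam i).gammaVol n w ≤ S.vol * Gv ^ ((fam i).K - n)) ∧
          |∑ X ∈ (L.fac K t τ).filter (fun X => ¬ dressed X) with R.u3.C.scale X = j,
              (EB (fun i => g (K + 1) (i + 1)) (uB K v) X - EB (fun i => g (K + 1) (i + 1)) L.oneB X)|
            ≤ |(fam i).eTerm j' (fam i).K w|) ∧
        -- (ii-d) the dressed sub-ledger ↔ N14's bookings on `R.ne1.𝒯`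
        (∀ K t, |t| ≤ S.l₀ → ∀ τ ∈ S.T K \ S.Bad K t, ∀ v ∈ Rd.dom,
          ∃ (pA : R.ne1.P) (βA : R.u3.C.Dom → (R.ne1.𝒯.B pA K).Birth) (Q : Finset (R.ne1.𝒯.B pA K).Cube) (pB : R.ne1.P)
            (KB : ℕ) (βB : R.u3.C.Dom → (R.ne1.𝒯.B pB KB).Birth),
          (∀ X ∈ (L.fac K t τ).filter (fun X => dressed X), (R.ne1.𝒯.B pA K).birthScale (βA X) = R.u3.C.scale X) ∧
          (∀ j, Set.InjOn βA ↑(((L.fac K t τ).filter (fun X => dressed X)).filter fun X => R.u3.C.scale X = j)) ∧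
          (∀ c ∈ Q, (R.ne1.𝒯.B pA K).cubeScale c = K) ∧ ((Q.card : ℝ) ≤ S.vol) ∧
          (∀ X ∈ (L.fac K t τ).filter (fun X => dressed X), ∃ c ∈ Q, βA X ∈ (R.ne1.𝒯.B pA K).feltAt c) ∧
          (∀ X ∈ (L.fac K t τ).filter (fun X => dressed X), KB - (R.ne1.𝒯.B pB KB).birthScale (βB X) = K - R.u3.C.scale X) ∧
          (∀ X ∈ (L.fac K t τ).filter (fun X => dressed X),
            |R.u3.EA (g K) (uA K v) X - R.u3.EA (g K) L.oneA X| ≤ (R.ne1.𝒯.B pA K).size (βA X) K) ∧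
          (∀ X ∈ (L.fac K t τ).filter (fun X => dressed X),
            |EB (fun i => g (K + 1) (i + 1)) (uB K v) X - EB (fun i => g (K + 1) (i + 1)) L.oneB X|
              ≤ (R.ne1.𝒯.B pB KB).size (βB X) KB)) ∧
        -- (v′-16) N16 BY NAME: THE END's regime letters of `R.ne3`, N07's interface, the selection, NE7 route-#1's side letters, the
        -- reading map, the action-reading identification, the offset, the gauge-domination convention
        R.ne3.g = gradConst 4 c' ∧ 2 ≤ R.ne3.L ∧ 1 ≤ R.ne3.Nper ∧ 0 ≤ R.ne3.b ∧ 0 ≤ c' ∧ R.ne3.b ≤ t ∧ c' ≤ t ∧ 0 ≤ R.ne3.C ∧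
        (2 : ℝ) ^ 91 * (R.ne3.L : ℝ) ^ 17 * t ≤ 1 ∧ (2 : ℝ) ^ 76 * (R.ne3.L : ℝ) ^ 12 * t ≤ R.ne3.ε ∧
        16 * B7Prop2Explicit.C0 4 * R.ne3.ε ≤ 3 ∧ 1024 * (4 + 1) * (4 + 4) * (R.ne3.L : ℝ) ^ 2 * R.ne3.ε ≤ 1 ∧
        ε₁ ≤ 1 / 4 ∧ ε₁ ≤ R.ne3.b ∧ 4 * ε₁ ≤ c' ∧ R.ne3.dom ⊆ sfClass 4 R.ne3.L R.ne3.Nper ε₁ 0 ∧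
        LeafH3sup 4 R.ne3.L R.ne3.Nper R.ne3.ε R.ne3.b c' R.ne3.dom ∧
        (∀ V ∈ R.ne3.dom, ∀ k : ℕ, IsMinimiser 4 (sfClass 4 R.ne3.L R.ne3.Nper R.ne3.ε) R.ne3.L R.ne3.Nper k V (sel k V)) ∧
        (∀ V ∈ R.ne3.dom, ∀ k : ℕ, RegularSup 4 R.ne3.L R.ne3.Nper R.ne3.b c' k (sel k V)) ∧
        0 < θ ∧ θ ^ 6 = ((R.ne3.L : ℝ))⁻¹ ∧ 0 < R.ne3.Λ₂' ∧ 0 < γ₃ ∧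
        R.ne3.C * (wallConst 4 R.ne3.L * (R.ne3.Nper : ℝ) ^ 2 *
          (Real.sqrt (gradConst 4 c') * dualC2 4 R.ne3.L + 2 * R.ne3.b ^ 2 * dualC1 4 R.ne3.L)) ≤ γ₃ ^ 3 ∧
        0 < l₁ ∧ R.ne3.Λ₁ ≤ l₁ ^ 3 ∧ γ₃ * θ ^ 2 ≤ l₁ * R.ne3.Nper ∧ θ ^ ((3 : ℝ) * β - 2) ≤ θ₃ ∧ θ₃ < 1 ∧
        (∀ v ∈ Rd.dom, rd v ∈ R.ne3.dom) ∧
        (∀ k, ∀ v ∈ Rd.dom, Rd.act k v = minAct 4 (sfClass 4 R.ne3.L R.ne3.Nper R.ne3.ε) R.ne3.L R.ne3.Nper k (rd v)) ∧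
        (R.ne3.Nper : ℝ) ^ 4 ≤ Rd.vol ∧ 1 ≤ k₀ ∧
        (∀ K : ℕ, ∀ v ∈ Rd.dom, ∀ (u : B7Prop1Explicit.Site 4 → (Matrix (Fin N) (Fin N) ℂ)ˣ)
          (Z : B7Prop1Explicit.Site 4 → Fin 4 → Matrix (Fin N) (Fin N) ℂ) (M : ℝ),
          IsUnitarySite u → IsPeriodicSite u ((R.ne3.Nper * R.ne3.L ^ (k₀ + K) : ℕ) : ℤ) → T4AveragingDeficitWall.IsSkewDir Z →
          IsPeriodicDir Z ((R.ne3.Nper * R.ne3.L ^ (k₀ + K) : ℕ) : ℤ) →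
          B7Prop1Explicit.gaugeAct u (sel (k₀ + K) (rd v)) =
            T4AveragingDeficitWall.vary (B7Prop2Explicit.rescale R.ne3.L (B7Prop1Explicit.bavg R.ne3.L (sel (k₀ + K + 1) (rd v)))) Z 1 →
          (∀ (x : B7Prop1Explicit.Site 4) (κ : Fin 4), (R.ne3.L : ℝ) ^ (k₀ + K) * ‖Z x κ‖ ≤ M) →
          (∀ (x : B7Prop1Explicit.Site 4) (μ κ : Fin 4), ((R.ne3.L : ℝ) ^ (k₀ + K)) ^ 2 *
              ‖T4AveragingDeficitWall.Ad (B7Prop2Explicit.rescale R.ne3.L (B7Prop1Explicit.bavg R.ne3.L (sel (k₀ + K + 1) (rd v)))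
                  (x + B7Prop1Explicit.e κ) μ) (Z (x + B7Prop1Explicit.e μ) κ) - Z x κ‖ ≤ M) →
          R.u3.C.gauge (uA K v) (R.u3.C.transport (uB K v)) ≤ M) ∧
        -- letter signs
        0 ≤ R.u3.θ ∧ 0 ≤ R.u3.C₅ ∧ 0 ≤ R.u3.ω ∧
        -- (v′-17) N17 BY NAME: the (0.20)-run identification, the infrared pin, (D4), the β-window, the smallness window, rates
        (∀ K, RGEqH K D.βfun (g K)) ∧ (∀ K, g K K = gIR) ∧ ReadOutAt D R.u3 ∧ 0 < bβ ∧
        EventualLowerH bβ R.u3.γ k₀β D.βfun ∧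
        R.u3.cr * R.u3.C₉ * R.u3.ω * (((k₀β : ℝ) + 1) * R.u3.γ ^ 3 + 2 * R.u3.γ / bβ) ≤ (1 - R.u3.ρ) / 2 ∧
        0 < R.u3.ρ ∧ R.u3.ρ < 1 ∧ 0 < R.u3.γ ∧ R.u3.ρ ≤ θc ∧
        -- the box
        (∀ K i, i ≤ K → 0 < g K i ∧ g K i ≤ R.u3.γ) ∧
        -- the bracket (T) IN THE TUBE CURRENCY (`N19LipBracketTube.lipBracket_at_rateCarriers_of_pairDisc`'s inputs): the (1.18) real
        -- bound; the pair-disc shape at the printed tube radius κ₁·α(C₁, q₁, s_j) ((2.27)(ii)(iv) through the (1.13)∕(2.39) tube — SHAPE,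
        -- NODE O); signs; the window's smallness; the UPPER running of the tables ((2.6) ∕ (0.31) upper half, β-side conditional, DISPLAYED)
        DecayBound R.u3.EA R.u3.W E₀T R.u3.κ ∧
        (∀ s ∈ R.u3.W, ∀ (X : R.u3.C.Dom) (U U' : R.u3.C.BgA),
          R.u3.C.gauge U U' < κ₁T * B14.alphaJ C₁T q₁ (s (R.u3.C.scale X)) →
          ∃ f : ℂ → ℂ, DifferentiableOn ℂ f (Metric.ball (0 : ℂ) (κ₁T * B14.alphaJ C₁T q₁ (s (R.u3.C.scale X)))) ∧
            f 0 = (R.u3.EA s U X : ℂ) ∧ f (R.u3.C.gauge U U' : ℂ) = (R.u3.EA s U' X : ℂ) ∧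
            ∀ z ∈ Metric.ball (0 : ℂ) (κ₁T * B14.alphaJ C₁T q₁ (s (R.u3.C.scale X))),
              ‖f z‖ ≤ E₀T * Real.exp (-(R.u3.κ * R.u3.C.d X))) ∧
        0 ≤ E₀T ∧ 0 < κ₁T ∧ 0 < C₁T ∧ (∀ s ∈ R.u3.W, ∀ j, 0 < s j ∧ s j ^ 2 ≤ Real.exp (-1)) ∧
        (∀ K j, j ≤ K → 1 / g K j ^ 2 ≤ 1 / gIR ^ 2 + β'T * ((K : ℝ) - j)) ∧ 0 ≤ β'T ∧
        -- window memberships, selector compatibility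
        (∀ K, g K ∈ R.u3.W) ∧ (∀ K, (fun i => g (K + 1) (i + 1)) ∈ R.u3.W) ∧
        (∀ s ∈ R.u3.W, 0 < bsel s ∧ bsel s ≤ R.u3.γ))

include hβ1 hlink

/-- ★ **LEAF D's N19 SLOT IN THE R-β CURRENCY, BY NAME, MODULO THE LINK READING AT THE RECORD TUPLES** [bookkeeping]: for every admissible Stage-13 `θ` with provisos
in the guard, every `g₀`, `os`, run length `k`: `RatesHolderAt (datumOfRecord₁₃CoPH F N θ hP) (rateCarriersOfRecord₁₃CoPH 𝔯 F θ hP g₀ os k) β → ∃ δ, NE7.Core (cr …) … δ ∧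
Summable δ` — the sibling's `rateEdge_of_linkReading_byName_pairDiscC1Holder` at the SAME-TUPLE pair predicate.  `hlink` (NODE O's world) is the displayed hypothesis;
NOT NE7; N19 NOT discharged. [folklore] -/
theorem h19Holder_datumOfRecord₁₃CoPH_of_linkReading
    (F : T4Family) (θ : Stage13HParams F N) (hP : θ.Provisos₁₃CoPH F N) (hG : G θ) (hθ : θ.Admissible F N) (g₀ : ℕ → ℝ) (os : List (ULoop F)) (k : ℕ)
    (hr : RatesHolderAt (datumOfRecord₁₃CoPH F N θ hP) (rateCarriersOfRecord₁₃CoPH 𝔯 F θ hP g₀ os k) β) :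
    letI := (cr F θ hP g₀ os).dec
    ∃ δ : ℕ → ℝ, NE7.Core (cr F θ hP g₀ os).l₀ (cr F θ hP g₀ os).vol (cr F θ hP g₀ os).T (cr F θ hP g₀ os).Bad
      (fun K t τ => (cr F θ hP g₀ os).A K t τ - (cr F θ hP g₀ os).shA K t τ) (fun K t τ => (cr F θ hP g₀ os).B K t τ - (cr F θ hP g₀ os).shB K t τ) δ ∧
      Summable δ :=
  rateEdge_of_linkReading_byName_pairDiscC1Holder
    (fun F D g₀ os S R => ∃ (θ : Stage13HParams F N) (hP : θ.Provisos₁₃CoPH F N) (k : ℕ), G θ ∧ θ.Admissible F N ∧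
      D = datumOfRecord₁₃CoPH F N θ hP ∧ S = cr F θ hP g₀ os ∧ R = rateCarriersOfRecord₁₃CoPH 𝔯 F θ hP g₀ os k)
    hβ1 (by
      rintro F D g₀ os S R ⟨θ, hP, k, hG, hθ, rfl, rfl, rfl⟩
      exact hlink F θ hP hG hθ g₀ os k)
    F _ g₀ os _ _ ⟨θ, hP, k, hG, hθ, rfl, rfl, rfl⟩ hr

/-! ## §2 dag-n27-c's guarded θ-keyed B5 (XXIVc) with N19's binder replaced by the link reading -/

/-- ★ **`HybridNE7Under` AT EVERY GUARDED ADMISSIBLE STAGE-13 TUPLE FROM N20 · N21 · K4's β-RATES · THE KEYED EXTRACTION · THE LINK READING** [bookkeeping]: XXIVc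
`keyedGuarded₁₃CoPH_of_keyedFacesRatesHolder` for the rate reading `rr F θ hP g₀ os := rateCarriersOfRecord₁₃CoPH 𝔯 F θ hP g₀ os (ks F θ hP g₀ os)` (ANY run-length
selector `ks`), its `h19` binder := §1.  Hypotheses `h20` (N20), `h21` (N21), `hrates` (K4), `hx` (N27), `hlink` (NODE O) displayed; NOT a discharge. [folklore] -/
theorem hybridNE7Under_guarded_datumOfRecord₁₃CoPH_of_keyedFacesRatesHolder_linkReading
    (ks : (F : T4Family) → (θ : Stage13HParams F N) → θ.Provisos₁₃CoPH F N → (ℕ → ℝ) → List (ULoop F) → ℕ)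
    (h20 : ∀ (F : T4Family) (θ : Stage13HParams F N) (hP : θ.Provisos₁₃CoPH F N), G θ → θ.Admissible F N → ∀ (g₀ : ℕ → ℝ) (os : List (ULoop F)),
      RelWeightBound (cr F θ hP g₀ os).l₀ (cr F θ hP g₀ os).T (cr F θ hP g₀ os).A (cr F θ hP g₀ os).B (cr F θ hP g₀ os).Bad (cr F θ hP g₀ os).W)
    (h21 : ∀ (F : T4Family) (θ : Stage13HParams F N) (hP : θ.Provisos₁₃CoPH F N), G θ → θ.Admissible F N → ∀ (g₀ : ℕ → ℝ) (os : List (ULoop F)),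
      ShellWeightBound (cr F θ hP g₀ os).l₀ (cr F θ hP g₀ os).T (cr F θ hP g₀ os).A (cr F θ hP g₀ os).B (cr F θ hP g₀ os).shA (cr F θ hP g₀ os).shB
        (cr F θ hP g₀ os).Wsh)
    (hrates : ∀ (F : T4Family) (θ : Stage13HParams F N) (hP : θ.Provisos₁₃CoPH F N), G θ → θ.Admissible F N → ∀ (g₀ : ℕ → ℝ) (os : List (ULoop F)),
      RatesHolderAt (datumOfRecord₁₃CoPH F N θ hP) (rateCarriersOfRecord₁₃CoPH 𝔯 F θ hP g₀ os (ks F θ hP g₀ os)) β)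
    (hx : ∀ (F : T4Family) (θ : Stage13HParams F N) (hP : θ.Provisos₁₃CoPH F N), G θ → θ.Admissible F N →
      B16.EndStatementBPrinted (datumOfRecord₁₃CoPH F N θ hP).C → DagBinding.EndpointExistence (datumOfRecord₁₃CoPH F N θ hP).C.toB12 →
        ForSmallCouplings (datumOfRecord₁₃CoPH F N θ hP) fun g₀ => ∀ os : List (ULoop F),
          0 < (cr F θ hP g₀ os).l₀ ∧ 0 < (cr F θ hP g₀ os).vol ∧
          (∀ (K : ℕ) (t : ℝ), |t| ≤ (cr F θ hP g₀ os).l₀ →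
            T4GenFunBounds.schemeZ ((datumOfRecord₁₃CoPH F N θ hP).scheme g₀) os ((cr F θ hP g₀ os).K₀ + K) t =
              ∑ τ ∈ (cr F θ hP g₀ os).T K, (cr F θ hP g₀ os).A K t τ) ∧
          (∀ (K : ℕ) (t : ℝ), |t| ≤ (cr F θ hP g₀ os).l₀ →
            T4GenFunBounds.schemeZ ((datumOfRecord₁₃CoPH F N θ hP).scheme g₀) os ((cr F θ hP g₀ os).K₀ + K + 1) t =
              ∑ τ ∈ (cr F θ hP g₀ os).T K, (cr F θ hP g₀ os).B K t τ))
    (F : T4Family) (θ : Stage13HParams F N) (hP : θ.Provisos₁₃CoPH F N) (hG : G θ) (hθ : θ.Admissible F N) :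
    HybridNE7Under (datumOfRecord₁₃CoPH F N θ hP) (DagBinding.EndpointExistence (datumOfRecord₁₃CoPH F N θ hP).C.toB12) :=
  keyedGuarded₁₃CoPH_of_keyedFacesRatesHolder cr (fun F θ hP g₀ os => rateCarriersOfRecord₁₃CoPH 𝔯 F θ hP g₀ os (ks F θ hP g₀ os)) G β h20 h21 hrates
    (fun F θ hP hG hθ g₀ os hr => h19Holder_datumOfRecord₁₃CoPH_of_linkReading cr 𝔯 G hβ1 hlink F θ hP hG hθ g₀ os (ks F θ hP g₀ os) hr) hx F θ hP hG hθ

end AtRecord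

end Summit.QuantumFields.YangMills.BalabanUVNodes.N19RateEdgeHolderAtRecord13CoPH

end
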